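import Literature.NumberTheory.LocalFields.PadicExpansionPeriodic
import HarnessLib

/-!
# Lacunary `p`-adic series are irrational: `Σ p^{n!} ∉ ℚ` (Robert, Ch. I §5.3 Corollary)

A. M. Robert, *A Course in p-adic Analysis* (GTM 198), Ch. I §5.3, Corollary of the Proposition
"rational ⟺ eventually periodic expansion" (held text, chunk 0168): «**Corollary.** The p-adic
integers `Σ p^{n²}` and `Σ p^{n!}` are not rational.» Sequel BY NAME of `PadicExpansionPeriodic.lean`
(the Proposition `eventually_periodic_padicDigit_iff`, the digits `padicDigit`, and the first example
`tsum_pow_sq_irrational`), supplying the second example through the general lacunary statement behind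
both: for a strictly increasing exponent sequence `e` the digits of `Σ p^{e(n)}` are `1` exactly on the
image of `e` (`padicDigit_tsum_pow_of_strictMono`, with `appr_tsum_pow_of_strictMono`,
`summable_pow_of_strictMono`), so they are not eventually periodic as soon as the gaps
`e(n+1) − e(n)` tend to infinity (`not_eventually_periodic_tsum_pow_of_tendsto_gaps`: a period `T`
from `N` on would put a `1` at `e(n) + T`, strictly between `e(n)` and `e(n+1)`), hence
**`tsum_pow_irrational_of_tendsto_gaps`**; §2: **`tsum_pow_factorial_succ_irrational`**
(`Σ_{n≥1} p^{n!}`, digits `padicDigit_tsum_pow_factorial_succ`) and **`tsum_pow_factorial_irrational`**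
(`Σ_{n≥0} p^{n!} = p + Σ_{n≥1} p^{n!}`, the literal reading with `0! = 1! = 1`). Theorems only; "not
rational" is phrased as in the parent file (`b·x = a` for integers `a`, `b ≠ 0` is impossible).

## References
* [Robert2000PadicAnalysis] A. M. Robert, *A Course in p-adic Analysis*, Graduate Texts in Mathematics
  198, Springer (2000), Ch. I §5.3 Proposition and Corollary (held text, chunks 0167–0168).
-/

noncomputable section

open Filter Finset
open scoped Topology Nat

namespace Literature.NumberTheory.LocalFields

variable {p : ℕ} [hp : Fact p.Prime]

/-! ## §1. The digits of a lacunary series `Σ p^{e(n)}` -/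

section Lacunary

variable {e : ℕ → ℕ}

/-- `‖p^m‖ ≤ p^{−N}` in `ℤ_p` for `N ≤ m`. [folklore] -/
private theorem norm_p_pow_le' {m N : ℕ} (h : N ≤ m) : ‖(p : ℤ_[p]) ^ m‖ ≤ (p : ℝ) ^ (-(N : ℤ)) := by
  rw [PadicInt.norm_p_pow]
  exact zpow_le_zpow_right₀ (by exact_mod_cast hp.out.one_lt.le) (by omega)

/-- `Σ p^{e(n)}` converges in `ℤ_p` for a strictly increasing exponent sequence `e`.
[cite: Robert2000PadicAnalysis, Ch. I §5.3 Corollary] -/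
theorem summable_pow_of_strictMono (he : StrictMono e) : Summable fun n : ℕ => (p : ℤ_[p]) ^ e n := by
  refine NonarchimedeanAddGroup.summable_of_tendsto_cofinite_zero ?_
  rw [Nat.cofinite_eq_atTop]
  have h1 : Tendsto (fun m : ℕ => (p : ℤ_[p]) ^ m) atTop (𝓝 0) := by
    refine tendsto_pow_atTop_nhds_zero_of_norm_lt_one ?_
    rw [PadicInt.norm_p]
    exact inv_lt_one_of_one_lt₀ (by exact_mod_cast hp.out.one_lt)
  exact h1.comp he.tendsto_atTop

/-- The canonical approximations of a lacunary series: `appr_N(Σ p^{e(n)}) = Σ_{e(n) < N} p^{e(n)}`.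
[cite: Robert2000PadicAnalysis, Ch. I §5.3 Corollary] -/
theorem appr_tsum_pow_of_strictMono (he : StrictMono e) (N : ℕ) :
    (∑' n, (p : ℤ_[p]) ^ e n).appr N = ∑ n ∈ (range N).filter (fun n => e n < N), p ^ e n := by
  have hp2 : 2 ≤ p := hp.out.two_le
  refine appr_eq_of_lt_of_sub_mem _ ?_ ?_
  · -- the exponents `e(n)` (`e(n) < N`) are distinct and `< N`
    rw [← Finset.sum_image (s := (range N).filter (fun n => e n < N)) (g := e)
      (f := fun m => p ^ m) (fun a _ b _ hab => he.injective hab)]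
    refine Nat.geomSum_lt hp2 fun m hm => ?_
    simp only [Finset.mem_image, Finset.mem_filter] at hm
    obtain ⟨n, ⟨_, hn⟩, rfl⟩ := hm
    exact hn
  · rw [← PadicInt.norm_le_pow_iff_mem_span_pow]
    rw [← (summable_pow_of_strictMono he).sum_add_tsum_nat_add N,
      ← Finset.sum_filter_add_sum_filter_not (range N) (fun n => e n < N)]
    push_cast
    rw [show ∀ a b c : ℤ_[p], a + b + c - a = b + c from fun a b c => by ring]
    refine (IsUltrametricDist.norm_add_le_max _ _).trans (max_le ?_ ?_)
    · refine IsUltrametricDist.norm_sum_le_of_forall_le_of_nonneg (by positivity) fun n hn => ?_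
      rw [Finset.mem_filter] at hn
      exact norm_p_pow_le' (by omega)
    · refine IsUltrametricDist.norm_tsum_le_of_forall_le_of_nonneg (by positivity) fun n => ?_
      have := he.le_apply (x := n + N)
      exact norm_p_pow_le' (by omega)

open Classical in
/-- **The digits of a lacunary series `Σ p^{e(n)}` (`e` strictly increasing) are `1` at the values of
`e` and `0` elsewhere.** [cite: Robert2000PadicAnalysis, Ch. I §5.3 Corollary] -/
theorem padicDigit_tsum_pow_of_strictMono (he : StrictMono e) (k : ℕ) :
    padicDigit (∑' n, (p : ℤ_[p]) ^ e n) k = if k ∈ Set.range e then 1 else 0 := by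
  classical
  have hp2 : 2 ≤ p := hp.out.two_le
  have hpk : 0 < p ^ k := Nat.pow_pos hp.out.pos
  rw [padicDigit_def, appr_tsum_pow_of_strictMono he]
  set s := (range (k + 1)).filter (fun n => e n < k + 1) with hs
  -- the part with `e(n) < k` is `< p^k`
  have hlow : ∑ n ∈ s.filter (fun n => e n < k), p ^ e n < p ^ k := by
    rw [← Finset.sum_image (s := s.filter (fun n => e n < k)) (g := e)
      (f := fun m => p ^ m) (fun a _ b _ hab => he.injective hab)]
    refine Nat.geomSum_lt hp2 fun m hm => ?_
    simp only [Finset.mem_image, Finset.mem_filter] at hm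
    obtain ⟨n, ⟨_, hn⟩, rfl⟩ := hm
    exact hn
  rw [← Finset.sum_filter_add_sum_filter_not s (fun n => e n < k)]
  -- the part with `e(n) = k`
  have htop : ∑ n ∈ s.filter (fun n => ¬ e n < k), p ^ e n =
      if k ∈ Set.range e then p ^ k else 0 := by
    have hmem : ∀ n, n ∈ s.filter (fun n => ¬ e n < k) ↔ e n = k := by
      intro n
      simp only [hs, Finset.mem_filter, Finset.mem_range]
      constructor
      · rintro ⟨⟨_, h1⟩, h2⟩; omega
      · intro h
        have := he.le_apply (x := n)
        refine ⟨⟨by omega, by omega⟩, by omega⟩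
    split_ifs with hsq
    · obtain ⟨r, hr⟩ := hsq
      have hset : s.filter (fun n => ¬ e n < k) = {r} := by
        ext n
        rw [hmem, Finset.mem_singleton]
        constructor
        · intro h; exact he.injective (h.trans hr.symm)
        · rintro rfl; exact hr
      rw [hset, Finset.sum_singleton, hr]
    · have hset : s.filter (fun n => ¬ e n < k) = ∅ := by
        ext n
        rw [hmem]
        simp only [Finset.notMem_empty, iff_false]
        intro h
        exact hsq ⟨n, h⟩
      rw [hset, Finset.sum_empty]
  rw [htop]
  split_ifs with hsq
  · rw [show ∑ n ∈ s.filter (fun n => e n < k), p ^ e n + p ^ k =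
        ∑ n ∈ s.filter (fun n => e n < k), p ^ e n + p ^ k * 1 by rw [mul_one],
      Nat.add_mul_div_left _ _ hpk, Nat.div_eq_of_lt hlow]
  · rw [add_zero, Nat.div_eq_of_lt hlow]

/-- **The digit sequence of a lacunary series is not eventually periodic** when the gaps
`e(n+1) − e(n)` tend to infinity: a period `T` from `N` on would force a `1` at `e(n) + T`, strictly
between `e(n)` and `e(n+1)`. [cite: Robert2000PadicAnalysis, Ch. I §5.3 Corollary] -/
theorem not_eventually_periodic_tsum_pow_of_tendsto_gaps (he : StrictMono e)
    (hgap : Tendsto (fun n => e (n + 1) - e n) atTop atTop) :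
    ¬ ∃ N T : ℕ, 0 < T ∧ ∀ n, N ≤ n →
      padicDigit (∑' n, (p : ℤ_[p]) ^ e n) (n + T) = padicDigit (∑' n, (p : ℤ_[p]) ^ e n) n := by
  rintro ⟨N, T, hT, hper⟩
  -- choose `n` with `e(n) ≥ N` and gap `e(n+1) − e(n) > T`
  obtain ⟨n, hn⟩ := ((tendsto_atTop.mp hgap (T + 1)).and
    (tendsto_atTop.mp he.tendsto_atTop N)).exists
  obtain ⟨hgapn, heN⟩ := hn
  have h := hper (e n) heN
  rw [padicDigit_tsum_pow_of_strictMono he, padicDigit_tsum_pow_of_strictMono he,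
    if_pos (Set.mem_range_self n)] at h
  have hmem : e n + T ∈ Set.range e := by
    by_contra hns
    rw [if_neg hns] at h
    exact zero_ne_one h
  obtain ⟨m, hm⟩ := hmem
  -- `e(n) < e(m) = e(n) + T < e(n+1)`, impossible for a strictly increasing `e`
  have h1 : e n < e m := by omega
  have h2 : e m < e (n + 1) := by omega
  have hnm : n < m := he.lt_iff_lt.mp h1
  have hmn : m < n + 1 := he.lt_iff_lt.mp h2
  omega

/-- **A lacunary series `Σ p^{e(n)}` with gaps `e(n+1) − e(n) → ∞` is not a rational number**
(by the Proposition of I.5.3: rational ⟺ eventually periodic digits).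
[cite: Robert2000PadicAnalysis, Ch. I §5.3 Corollary] -/
theorem tsum_pow_irrational_of_tendsto_gaps (he : StrictMono e)
    (hgap : Tendsto (fun n => e (n + 1) - e n) atTop atTop) :
    ¬ ∃ a b : ℤ, b ≠ 0 ∧ (b : ℤ_[p]) * (∑' n, (p : ℤ_[p]) ^ e n) = a := by
  rw [← eventually_periodic_padicDigit_iff]
  exact not_eventually_periodic_tsum_pow_of_tendsto_gaps he hgap

end Lacunary

/-! ## §2. `Σ p^{n!}` -/

section Factorial

/-- The gaps `(n+2)! − (n+1)! = (n+1)·(n+1)!` tend to infinity. [folklore] -/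
private theorem tendsto_factorial_gaps :
    Tendsto (fun n => (n + 1 + 1)! - (n + 1)!) atTop atTop := by
  refine tendsto_atTop_mono (fun n => ?_) tendsto_id
  have h1 : (n + 1 + 1)! - (n + 1)! = (n + 1) * (n + 1)! := by
    rw [Nat.factorial_succ (n + 1)]
    exact Nat.sub_eq_of_eq_add (by ring)
  rw [h1]
  calc id n = n := rfl
    _ ≤ n + 1 := Nat.le_succ n
    _ = (n + 1) * 1 := (mul_one _).symm
    _ ≤ (n + 1) * (n + 1)! := Nat.mul_le_mul_left _ (Nat.factorial_pos _)

/-- `n ↦ (n+1)!` is strictly increasing. [folklore] -/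
private theorem strictMono_factorial_succ : StrictMono fun n : ℕ => (n + 1)! :=
  strictMono_nat_of_lt_succ fun n =>
    Nat.factorial_lt_of_lt (Nat.succ_pos n) (Nat.lt_succ_self (n + 1))

open Classical in
/-- The digits of `Σ_{n≥1} p^{n!}` are `1` exactly at the factorials.
[cite: Robert2000PadicAnalysis, Ch. I §5.3 Corollary] -/
theorem padicDigit_tsum_pow_factorial_succ (k : ℕ) :
    padicDigit (∑' n, (p : ℤ_[p]) ^ (n + 1)!) k = if k ∈ Set.range (fun n : ℕ => (n + 1)!) then 1 else 0 :=
  padicDigit_tsum_pow_of_strictMono strictMono_factorial_succ k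

/-- **Corollary (Robert I.5.3): `Σ_{n≥1} p^{n!}` is not rational** (written `Σ_{n≥0} p^{(n+1)!}`).
[cite: Robert2000PadicAnalysis, Ch. I §5.3 Corollary] -/
theorem tsum_pow_factorial_succ_irrational :
    ¬ ∃ a b : ℤ, b ≠ 0 ∧ (b : ℤ_[p]) * (∑' n, (p : ℤ_[p]) ^ (n + 1)!) = a :=
  tsum_pow_irrational_of_tendsto_gaps strictMono_factorial_succ tendsto_factorial_gaps

/-- **Corollary (Robert I.5.3): "the `p`-adic integer `Σ p^{n!}` is not rational"** — with the sum
over all `n ≥ 0` (`0! = 1! = 1`, so `Σ_{n≥0} p^{n!} = p + Σ_{n≥1} p^{n!}` differs from the previous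
series by the rational number `p`). [cite: Robert2000PadicAnalysis, Ch. I §5.3 Corollary] -/
theorem tsum_pow_factorial_irrational :
    ¬ ∃ a b : ℤ, b ≠ 0 ∧ (b : ℤ_[p]) * (∑' n, (p : ℤ_[p]) ^ n !) = a := by
  rintro ⟨a, b, hb, h⟩
  have hs : Summable fun n : ℕ => (p : ℤ_[p]) ^ n ! :=
    (summable_nat_add_iff (f := fun n : ℕ => (p : ℤ_[p]) ^ n !) 1).mp
      (summable_pow_of_strictMono strictMono_factorial_succ)
  rw [hs.tsum_eq_zero_add, Nat.factorial_zero, pow_one] at h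
  refine tsum_pow_factorial_succ_irrational (p := p) ⟨a - b * p, b, hb, ?_⟩
  push_cast
  linear_combination h

end Factorial

end Literature.NumberTheory.LocalFields
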